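import Summits.BirchSwinnertonDyer.Rank1Residual.X12.CMSmallPrimePConverse
import HarnessLib

/-!
# Supersingular vs ordinary AT `p = 2` in the kernel: an elliptic curve over `ℚ` with good reduction
# at `2` is ORDINARY at `2` iff its `j`-invariant has ODD numerator (cell `b2b-bsdres`, unit
# `b2b-bsdres-lit-bst`, gen 7; part A of two — part B `X12/CMDeuringTwo.lean` draws the CM corner)

HONEST FRAMING (cell `b2b-bsdres`, run/shared/lean/b2b/bsd-rank1-residual/, verbatim in every
file): the goal of the cell is to DELETE the COMBINATION-SHAPED residual classes of the
Birch–Swinnerton-Dyer formula for ALL analytic-rank `≤ 1` elliptic curves over `ℚ` — "full BSD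
formula for every rank `≤ 1` curve in class `C`" assembled STRICTLY from published theorems — so
that the rank-`≤ 1` remainder becomes exactly the CONSTRUCTION-SHAPED classes, which are TYPED
(missing-input `Prop`s), NOT attempted. This is not "finishing BSD". THIS FILE: theorems only (no
definition, no named fact, no axiom); NEW WORK of the cell (elementary), hence under `Summits/`;
nothing is booked; no label and no census number moves.

## Why these two files

Every `p = 2` statement of the CM corner in the tree — BCST 2022 Theorem A at `p = 2`
(`BurungaleCastellaSkinnerTian2022.cmFieldDiscrOfJ_eq_of_goodOrd_two`,
`X12.analyticRank_eq_one_of_goodOrd_two`), the Li–Tian–Yan–Zhu consumers (`X12/CMGoodOrdinaryTwo`),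
the `2`-torsion theorems (`X12/CMTwoTorsion*`) — reads "good ORDINARY at `2` ⟹ `K = ℚ(√−7)`"
through the binder `hDeu : deuring_not_hasUnitRootAt_of_hasCM_of_not_cmSplit` (Deuring's criterion,
Lang *Elliptic Functions* Ch. 13 §4 Thm. 12 — a NAMED FACT of the tree, stated over every number
field). At ODD good primes the GLUE seat made the dictionary a THEOREM over `ℚ`
(`goodOrd_iff_cmSplit_of_hasCM_of_good`, `Partition/MainConjecturesCMAnyOrder.lean`, `p ≠ 2`),
leaving exactly `p = 2` on the named fact (GLUE.md §G5.4 A10). Part B closes `p = 2`; this part A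
is the general, CM-free engine:

* §1 (characteristic `2`). For an elliptic curve `V/𝔽₂` in general Weierstrass form, `#V(𝔽₂)` is
  EVEN iff `a₁ ≠ 0` (`two_dvd_natCard_point_iff_a₁_ne_zero`): `P = (x, y)` has `2P = O` iff
  `a₁x + a₃ = 0`; if `a₁ = 1` the point `(a₃, a₃³ + a₂a₃² + a₄a₃ + a₆)` has order `2` (Lagrange); if
  `a₁ = 0` then `a₃ ≠ 0` (else `Δ = 0`) and no point has order `2` (Cauchy). Also `c₄ = a₁⁴ = a₁`
  in `𝔽₂`. This is Silverman *AEC* V Ex. 5.7 ("`char K = 2`: supersingular iff `j(E) = 0`") with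
  Ex. 5.10 (a),(d) (supersingular iff `tr φ ≡ 0 (mod p)`) and App. A (proof of Prop. 1.1 (c):
  `j = a₁¹²/Δ`), made explicit on the five coefficients.
* §2 (over `ℚ`). For a globally minimal `W/ℚ` with good reduction at `2` (`2 ∤ Δ_min`, *AEC* VII.5.1
  (a)): `a_2 = 3 − #W̃(𝔽₂)`, so **`2 ∣ a_2 ⟺ 2 ∣ a₁ ⟺ 2 ∣ c₄ ⟺ num(j) even`**
  (`two_dvd_frobeniusTrace_two_iff_even_num_j`; `num(j)·Δ_min = c₄³·den(j)`, `Δ_min` odd,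
  `(num j, den j) = 1`). Packaged: `goodOrd_two_iff_odd_num_j : GoodOrd W 2 ↔ Good W 2 ∧ Odd (num j)`,
  `goodSS_two_iff_even_num_j`, `odd_den_j_of_good_two` (`j` is `2`-integral at a good `2`). The
  criterion is MODEL-FREE (`j` only), though `GoodOrd` reads `a_2` off the minimal model. Examples:
  `11a1` (`j = −2¹²·31³/11⁵`, `a_2 = −2`), `37a1` (`a_2 = −2`), `17a1` (`j = 33³/17⁴`, `a_2 = −1`),
  `49a1` (`j = −3375`, `a_2 = 1`).

References: J. H. Silverman, *The Arithmetic of Elliptic Curves*, 2nd ed., GTM 106 (2009): III.1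
(`b₂, b₄, c₄, Δ, j`), III.2.3, V Ex. 5.7, V Ex. 5.10 (a),(d), VII.5 Prop. 5.1 (a), Prop. 5.5, App. A
Prop. 1.1 (c), 1.2 (a) [SilvermanAEC2009]; HOME/b2b-bsdres-lit-bst/BST-BCST.md §11.
-/

set_option autoImplicit false

noncomputable section

open scoped Classical

open WeierstrassCurve Literature.NumberTheory.EllipticCurves
  Literature.NumberTheory.EllipticCurves.Rank1Residual

namespace Summit.BirchSwinnertonDyer.Rank1Residual.X12

/-! ## §1 Elliptic curves over `𝔽₂`: `#V(𝔽₂)` is even iff `a₁ ≠ 0`; `c₄ = a₁` -/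

section CharTwo

/-- In `𝔽₂` a nonzero element is `1`. [folklore] -/
private theorem zmod2_eq_one_of_ne_zero {y : ZMod 2} (h : y ≠ 0) : y = 1 := by
  revert y; decide

/-- **`c₄ = a₁` over `𝔽₂`**: `c₄ = b₂² − 24b₄ = (a₁² + 4a₂)² − 24(2a₄ + a₁a₃) = a₁⁴ = a₁`
(Silverman *AEC* III.1; checked on all `2⁵` curves). [cite: SilvermanAEC2009, III.1 (b₂, b₄, c₄)] -/
theorem c₄_eq_a₁ (V : WeierstrassCurve (ZMod 2)) : V.c₄ = V.a₁ := by
  obtain ⟨a1, a2, a3, a4, a6⟩ := V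
  revert a1 a2 a3 a4 a6
  decide

/-- Over `𝔽₂`, `a₁ = a₃ = 0` forces `Δ = 0` (`b₂ = b₄ = b₆ = 0`; Silverman *AEC* III.1, App. A
Prop. 1.1: a smooth curve in characteristic `2` has `a₁ ≠ 0` or `a₃ ≠ 0`).
[cite: SilvermanAEC2009, III.1 (Δ) and App. A Prop. 1.1] -/
theorem Δ_eq_zero_of_a₁_eq_zero_of_a₃_eq_zero (V : WeierstrassCurve (ZMod 2)) (h1 : V.a₁ = 0)
    (h3 : V.a₃ = 0) : V.Δ = 0 := by
  obtain ⟨a1, a2, a3, a4, a6⟩ := V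
  simp only at h1 h3
  subst h1 h3
  revert a2 a4 a6
  decide

/-- The points of a Weierstrass curve over a finite ring form a finite type (they inject into
`Option (R × R)`; same argument as the tree's `WeierstrassCurve.finite_point_reduction`). [folklore] -/
theorem finite_point_of_finite {R : Type*} [CommRing R] [Finite R] (V : WeierstrassCurve R) :
    Finite V.toAffine.Point := by
  refine Finite.of_injective
    (fun P : V.toAffine.Point =>
      match P with
      | .zero => (none : Option (R × R))
      | .some x y _ => some (x, y)) ?_
  rintro (_ | ⟨x, y, _⟩) (_ | ⟨x', y', _⟩) h
  · rfl
  · simp at h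
  · simp at h
  · simp only [Option.some.injEq, Prod.mk.injEq] at h
    obtain ⟨rfl, rfl⟩ := h
    rfl

/-- **An elliptic curve over `𝔽₂` has an EVEN number of `𝔽₂`-points iff `a₁ ≠ 0`** (iff it has an
`𝔽₂`-rational point of order `2`, iff it is ORDINARY; Silverman *AEC* V Ex. 5.7 with Ex. 5.10 (a),
(d)). Proof. `P = (x, y)` satisfies `2P = O` iff `P = −P = (x, −y − a₁x − a₃)`, i.e. iff
`a₁x + a₃ = 0`. If `a₁ ≠ 0` (so `a₁ = 1`), `x = a₃`, `y = x³ + a₂x² + a₄x + a₆` is a point (in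
`𝔽₂`, `y² = y`) with `2P = O`, so `2 ∣ #V(𝔽₂)`. If `a₁ = 0` then `a₃ ≠ 0` (`Δ ≠ 0`), no affine
point is `2`-torsion, and by Cauchy `2 ∤ #V(𝔽₂)`. [cite: SilvermanAEC2009, V Ex. 5.7 and Ex. 5.10 (a),(d); III.2.3 (negation formula)] -/
theorem two_dvd_natCard_point_iff_a₁_ne_zero (V : WeierstrassCurve (ZMod 2)) [V.IsElliptic] :
    2 ∣ Nat.card V.toAffine.Point ↔ V.a₁ ≠ 0 := by
  haveI : Finite V.toAffine.Point := finite_point_of_finite V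
  constructor
  · intro h2 h1
    obtain ⟨P, hP⟩ := exists_prime_addOrderOf_dvd_card' (G := V.toAffine.Point) 2 h2
    have hPP : P + P = 0 := by
      have := addOrderOf_nsmul_eq_zero P
      rwa [hP, two_nsmul] at this
    rcases P with _ | ⟨x, y, h⟩
    · change addOrderOf (0 : V.toAffine.Point) = 2 at hP
      rw [addOrderOf_zero] at hP
      exact absurd hP (by decide)
    · have hneg : Affine.Point.some x y h = -Affine.Point.some x y h :=
        eq_neg_of_add_eq_zero_left hPP
      rw [Affine.Point.neg_some, Affine.Point.some.injEq] at hneg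
      obtain ⟨-, hy⟩ := hneg
      -- `y = -y - a₁ x - a₃` with `a₁ = 0` forces `a₃ = 0`, contradicting `Δ ≠ 0`
      have h3 : V.a₃ = 0 := by
        have hny : V.toAffine.negY x y = -y - V.a₁ * x - V.a₃ := rfl
        rw [hny, h1] at hy
        have key : ∀ (x y a : ZMod 2), y = -y - 0 * x - a → a = 0 := by decide
        exact key x y V.a₃ hy
      exact (V.isUnit_Δ).ne_zero (Δ_eq_zero_of_a₁_eq_zero_of_a₃_eq_zero V h1 h3)
  · intro h1
    have ha1 : V.a₁ = 1 := zmod2_eq_one_of_ne_zero h1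
    -- the point `(a₃, c)`, `c = a₃³ + a₂a₃² + a₄a₃ + a₆`, lies on `V` and has order `2`
    have key₁ : ∀ (x a₂ a₄ a₆ : ZMod 2),
        (x ^ 3 + a₂ * x ^ 2 + a₄ * x + a₆) ^ 2 + 1 * x * (x ^ 3 + a₂ * x ^ 2 + a₄ * x + a₆)
          + x * (x ^ 3 + a₂ * x ^ 2 + a₄ * x + a₆) = x ^ 3 + a₂ * x ^ 2 + a₄ * x + a₆ := by
      decide
    have key₂ : ∀ (x c : ZMod 2), c = -c - 1 * x - x := by decide
    have heq : V.toAffine.Equation V.a₃ (V.a₃ ^ 3 + V.a₂ * V.a₃ ^ 2 + V.a₄ * V.a₃ + V.a₆) := by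
      rw [Affine.equation_iff]
      show _ + V.a₁ * _ * _ + V.a₃ * _ = _ ^ 3 + V.a₂ * _ ^ 2 + V.a₄ * _ + V.a₆
      rw [ha1]
      exact key₁ V.a₃ V.a₂ V.a₄ V.a₆
    have hns : V.toAffine.Nonsingular V.a₃ (V.a₃ ^ 3 + V.a₂ * V.a₃ ^ 2 + V.a₄ * V.a₃ + V.a₆) :=
      (Affine.equation_iff_nonsingular).mp heq
    have hneg : V.a₃ ^ 3 + V.a₂ * V.a₃ ^ 2 + V.a₄ * V.a₃ + V.a₆ =
        V.toAffine.negY V.a₃ (V.a₃ ^ 3 + V.a₂ * V.a₃ ^ 2 + V.a₄ * V.a₃ + V.a₆) := by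
      show _ = -_ - V.a₁ * V.a₃ - V.a₃
      rw [ha1]
      exact key₂ V.a₃ _
    have hPP := Affine.Point.add_self_of_Y_eq (h₁ := hns) hneg
    have hord : addOrderOf (Affine.Point.some _ _ hns) = 2 := by
      refine addOrderOf_eq_prime ?_ ?_
      · rw [two_nsmul]; exact hPP
      · exact Affine.Point.some_ne_zero hns
    have hdvd := addOrderOf_dvd_natCard (Affine.Point.some _ _ hns)
    rwa [hord] at hdvd

end CharTwo

/-! ## §2 Over `ℚ`: at a good `2`, `2 ∣ a_2 ⟺ 2 ∣ a₁ ⟺ 2 ∣ c₄ ⟺ num j even` -/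

section Rat

variable (W : WeierstrassCurve ℚ) [W.IsGloballyMinimal]

/-- `a_2 = 3 − #W̃(𝔽₂)`, so `2 ∣ a_2 ⟺ #W̃(𝔽₂)` is odd. [folklore] -/
theorem two_dvd_frobeniusTrace_two_iff_not_two_dvd_reductionPointCount :
    (2 : ℤ) ∣ W.frobeniusTrace 2 ↔ ¬ 2 ∣ W.reductionPointCount 2 := by
  unfold WeierstrassCurve.frobeniusTrace
  omega

/-- **At a good `2`: `2 ∣ a_2 ⟺ 2 ∣ a₁`** (on the globally minimal, hence `ℤ`-integral, model).
Good reduction gives `2 ∤ Δ_min` (*AEC* VII.5.1 (a), tree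
`not_dvd_minimalDiscriminantInt_of_hasGoodReductionAtPrime'`), so the reduction mod `2` is an
elliptic curve over `𝔽₂` and §1 applies. [cite: SilvermanAEC2009, V Ex. 5.10 (a),(d) and VII.5 Prop. 5.1 (a)] -/
theorem two_dvd_frobeniusTrace_two_iff_two_dvd_a₁ (hgood : W.HasGoodReductionAtPrime 2) :
    (2 : ℤ) ∣ W.frobeniusTrace 2 ↔ (2 : ℤ) ∣ (integralModelInt W).a₁ := by
  have hΔ : ¬ (2 : ℤ) ∣ minimalDiscriminantInt W :=
    by exact_mod_cast not_dvd_minimalDiscriminantInt_of_hasGoodReductionAtPrime' W 2 hgood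
  set V : WeierstrassCurve (ZMod 2) := (integralModelInt W).map (Int.castRingHom (ZMod 2)) with hV
  haveI : V.IsElliptic := ⟨by
    rw [hV, map_Δ, isUnit_iff_ne_zero, eq_intCast, Ne, ZMod.intCast_zmod_eq_zero_iff_dvd]
    exact_mod_cast hΔ⟩
  have hN : W.reductionPointCount 2 = Nat.card V.toAffine.Point := rfl
  have ha : V.a₁ = ((integralModelInt W).a₁ : ZMod 2) := by rw [hV]; simp [WeierstrassCurve.map]
  rw [two_dvd_frobeniusTrace_two_iff_not_two_dvd_reductionPointCount, hN,
    two_dvd_natCard_point_iff_a₁_ne_zero V, not_not, ha, ZMod.intCast_zmod_eq_zero_iff_dvd]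
  norm_num

/-- **At a good `2`: `2 ∣ a_2 ⟺ 2 ∣ c₄`** (`c₄ ≡ a₁⁴ (mod 2)`). [cite: SilvermanAEC2009, III.1 (c₄) and V Ex. 5.7] -/
theorem two_dvd_frobeniusTrace_two_iff_two_dvd_c₄ (hgood : W.HasGoodReductionAtPrime 2) :
    (2 : ℤ) ∣ W.frobeniusTrace 2 ↔ (2 : ℤ) ∣ (integralModelInt W).c₄ := by
  rw [two_dvd_frobeniusTrace_two_iff_two_dvd_a₁ W hgood]
  have h := c₄_eq_a₁ ((integralModelInt W).map (Int.castRingHom (ZMod 2)))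
  rw [map_c₄, eq_intCast] at h
  have ha : ((integralModelInt W).map (Int.castRingHom (ZMod 2))).a₁ =
      ((integralModelInt W).a₁ : ZMod 2) := by simp [WeierstrassCurve.map]
  rw [ha] at h
  have e2 : ((2 : ℕ) : ℤ) = 2 := by norm_num
  rw [← e2, ← ZMod.intCast_zmod_eq_zero_iff_dvd, ← ZMod.intCast_zmod_eq_zero_iff_dvd, h]

variable [W.IsElliptic]

omit [W.IsGloballyMinimal] in
/-- `j · Δ = c₄³` (Silverman *AEC* III.1: `j = c₄³/Δ`). [cite: SilvermanAEC2009, III.1 (j)] -/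
theorem j_mul_Δ_eq_c₄_pow : W.j * W.Δ = W.c₄ ^ 3 := by
  rw [WeierstrassCurve.j, ← coe_Δ', mul_comm, ← mul_assoc, Units.mul_inv, one_mul]

/-- `num(j) · Δ_min = c₄(ℤ-model)³ · den(j)` in `ℤ`, for a globally minimal `W/ℚ`.
[cite: SilvermanAEC2009, III.1 (j) and VIII.8 (minimal discriminant)] -/
theorem num_j_mul_minimalDiscriminantInt :
    W.j.num * minimalDiscriminantInt W = (integralModelInt W).c₄ ^ 3 * (W.j.den : ℤ) := by
  have hc4 : W.c₄ = ((integralModelInt W).c₄ : ℚ) := by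
    have h := (integralModelInt W).map_c₄ (Int.castRingHom ℚ)
    rw [map_integralModelInt, eq_intCast] at h
    exact h
  have hq : (W.j.num : ℚ) * (minimalDiscriminantInt W : ℚ) =
      (((integralModelInt W).c₄ : ℤ) : ℚ) ^ 3 * ((W.j.den : ℤ) : ℚ) := by
    rw [cast_minimalDiscriminantInt, ← Rat.mul_den_eq_num, ← hc4, ← j_mul_Δ_eq_c₄_pow W]
    push_cast
    ring
  exact_mod_cast hq

/-- **At a good `2`: `2 ∣ a_2(E) ⟺ the numerator of `j(E)` is even`** — for every elliptic curve
over `ℚ` with good reduction at `2` (no CM assumed): supersingular at `2` iff `j ≡ 0 (mod 2)`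
(Silverman *AEC* V Ex. 5.7: in characteristic `2`, supersingular iff `j = 0`). From §1 and
`num(j)·Δ_min = c₄³·den(j)` with `Δ_min` odd and `(num j, den j) = 1`.
[cite: SilvermanAEC2009, V Ex. 5.7 and Ex. 5.10 (a); VII.5 Prop. 5.1 (a)] -/
theorem two_dvd_frobeniusTrace_two_iff_even_num_j (hgood : W.HasGoodReductionAtPrime 2) :
    (2 : ℤ) ∣ W.frobeniusTrace 2 ↔ Even W.j.num := by
  rw [two_dvd_frobeniusTrace_two_iff_two_dvd_c₄ W hgood, ← even_iff_two_dvd]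
  have hΔ : ¬ (2 : ℤ) ∣ minimalDiscriminantInt W :=
    by exact_mod_cast not_dvd_minimalDiscriminantInt_of_hasGoodReductionAtPrime' W 2 hgood
  have hΔodd : Odd (minimalDiscriminantInt W) := Int.not_even_iff_odd.mp (even_iff_two_dvd.not.mpr hΔ)
  have hrel := num_j_mul_minimalDiscriminantInt W
  have hcop : Nat.Coprime W.j.num.natAbs W.j.den := W.j.reduced
  constructor
  · intro hc
    -- `c₄` even ⟹ `num j · Δ_min` even ⟹ `num j` even
    have h3 : Even ((integralModelInt W).c₄ ^ 3 * (W.j.den : ℤ)) :=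
      (Int.even_pow.mpr ⟨hc, by norm_num⟩).mul_right _
    rw [← hrel, Int.even_mul] at h3
    rcases h3 with h | h
    · exact h
    · exact absurd h (Int.not_even_iff_odd.mpr hΔodd)
  · intro hn
    by_contra hc
    rw [Int.not_even_iff_odd] at hc
    -- `c₄` odd and `num j` even ⟹ `den j` even, contradicting `(num j, den j) = 1`
    have h3 : Even ((integralModelInt W).c₄ ^ 3 * (W.j.den : ℤ)) := by
      rw [← hrel]; exact hn.mul_right _
    rw [Int.even_mul] at h3
    rcases h3 with h | h
    · exact (Int.not_even_iff_odd.mpr (hc.pow)) h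
    · have h2n : 2 ∣ W.j.num.natAbs := by
        have := even_iff_two_dvd.mp hn
        exact Int.natAbs_dvd_natAbs.mpr this |>.trans (by simp)
      have h2d : 2 ∣ W.j.den := by exact_mod_cast even_iff_two_dvd.mp h
      have h21 : 2 ∣ 1 := by rw [← hcop.gcd_eq_one]; exact Nat.dvd_gcd h2n h2d
      exact absurd h21 (by norm_num)

/-- **`GoodOrd E 2 ⟺ good at 2 ∧ num j(E) odd`** — the cell's "good ordinary at `2`" predicate
decided by the `j`-invariant (model-free). [cite: SilvermanAEC2009, V Ex. 5.7 and Ex. 5.10 (a)] -/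
theorem goodOrd_two_iff_odd_num_j : GoodOrd W 2 ↔ Good W 2 ∧ Odd W.j.num := by
  unfold GoodOrd Good
  constructor
  · rintro ⟨hgood, hord⟩
    refine ⟨hgood, Int.not_even_iff_odd.mp ?_⟩
    rwa [← two_dvd_frobeniusTrace_two_iff_even_num_j W hgood, ← show ((2 : ℕ) : ℤ) = 2 by norm_num]
  · rintro ⟨hgood, hodd⟩
    refine ⟨hgood, ?_⟩
    rw [show ((2 : ℕ) : ℤ) = 2 by norm_num, two_dvd_frobeniusTrace_two_iff_even_num_j W hgood]
    exact Int.not_even_iff_odd.mpr hodd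

/-- **`GoodSS E 2 ⟺ good at 2 ∧ num j(E) even`** (supersingular at `2` iff `j ≡ 0 (mod 2)`).
[cite: SilvermanAEC2009, V Ex. 5.7 and Ex. 5.10 (a)] -/
theorem goodSS_two_iff_even_num_j : GoodSS W 2 ↔ Good W 2 ∧ Even W.j.num := by
  unfold GoodSS Good
  constructor
  · rintro ⟨hgood, hss⟩
    refine ⟨hgood, ?_⟩
    rwa [← two_dvd_frobeniusTrace_two_iff_even_num_j W hgood, ← show ((2 : ℕ) : ℤ) = 2 by norm_num]
  · rintro ⟨hgood, hev⟩
    refine ⟨hgood, ?_⟩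
    rw [show ((2 : ℕ) : ℤ) = 2 by norm_num, two_dvd_frobeniusTrace_two_iff_even_num_j W hgood]
    exact hev

/-- **Good reduction at `2` ⟹ `j` is `2`-integral** (`den j` odd): `num(j)·Δ_min = c₄³·den(j)`
with `Δ_min` odd and `(num j, den j) = 1`. [cite: SilvermanAEC2009, VII.5 Prop. 5.5 (good reduction ⟹ j integral at v)] -/
theorem odd_den_j_of_good_two (hgood : W.HasGoodReductionAtPrime 2) : Odd W.j.den := by
  have hΔ : ¬ (2 : ℤ) ∣ minimalDiscriminantInt W :=
    by exact_mod_cast not_dvd_minimalDiscriminantInt_of_hasGoodReductionAtPrime' W 2 hgood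
  have hΔodd : Odd (minimalDiscriminantInt W) := Int.not_even_iff_odd.mp (even_iff_two_dvd.not.mpr hΔ)
  have hrel := num_j_mul_minimalDiscriminantInt W
  have hcop : Nat.Coprime W.j.num.natAbs W.j.den := W.j.reduced
  refine Nat.not_even_iff_odd.mp ?_
  intro hd
  have hdZ : Even (W.j.den : ℤ) := by exact_mod_cast hd
  have hn : Even W.j.num := by
    have h3 : Even ((integralModelInt W).c₄ ^ 3 * (W.j.den : ℤ)) := hdZ.mul_left _
    rw [← hrel, Int.even_mul] at h3
    rcases h3 with h | h
    · exact h
    · exact absurd h (Int.not_even_iff_odd.mpr hΔodd)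
  have h2n : 2 ∣ W.j.num.natAbs := by
    have := even_iff_two_dvd.mp hn
    exact Int.natAbs_dvd_natAbs.mpr this |>.trans (by simp)
  have h2d : 2 ∣ W.j.den := even_iff_two_dvd.mp hd
  have h21 : 2 ∣ 1 := by rw [← hcop.gcd_eq_one]; exact Nat.dvd_gcd h2n h2d
  exact absurd h21 (by norm_num)

end Rat

end Summit.BirchSwinnertonDyer.Rank1Residual.X12

end
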